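import Summits.CriticalPhenomena.PercolationContinuityZ3.Theorems.PercNearOneGluingNoHeavyLowerTailOneLayerTwoFingerCore
import HarnessLib

/-!
# `NoHeavyLowerTail` (stmt-CriticalPhenomena-4575), |A| = 5 rung — the glued half `X′(5)@o` for ONE-LAYER observer-relays (part 3 of 3)

Support file (prover prim-cplus-engine gen 11; `--supports stmt-CriticalPhenomena-4575`). No definition, no named fact,
no sorry.  Memo: run/shared/lean/prim/prim-cplus-engine/ENGINE-g11.md §4 (THEOREM OL).

SETTING. `μ = prodBernoulli w` on a finite vertex type; an observer `o` and four targets `a, b, c, d` (distinct, `≠ o`);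
`o` is ONE-LAYER: every pair `s(o,u)` with `u ∉ {a,b,c,d}` has weight `0` (the four "hairs" `s(o,a), …, s(o,d)` carry
arbitrary weights `h_a, h_b, h_c, h_d`; the graph off `o` is arbitrary).  Write `q_x = 1 − h_x` and
`N′ = #{x ∈ {a,b,c,d} : o ↔ x}`.

THEOREM (`oneLayer_openConn_weakestHair_le_twoFingers`).  If `a` carries the smallest hair (`h_a ≤ h_b, h_c, h_d`) and
`q_a q_b q_c q_d ≤ 1/4`, then   `μ(o ↔ a) ≤ μ(N′ ≥ 2)`   (`{N′ ≥ 2}` = some two of the four targets are both joined to `o`).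
COROLLARY (`oneLayer_twoFingerHub_glued`).  Under the same hair condition, `μ(o ↔ x) ≤ μ(N′ ≥ 2)` for any target `x`
with `μ(o ↔ x) ≤ μ(o ↔ a)`; in particular `min_x μ(o ↔ x) ≤ μ(N′ ≥ 2)`, i.e. `μ(N′ ≤ 1) ≤ max_x μ(o ↮ x)` — this is
`X′(5)` at `a = o` (= `C6`, the glued half of the |A| = 5 one-cut rung, prim-a5/ASSEMBLY.md §8) for every one-layer
observer-relay.  The regime hypothesis of `X′(5)`, `Σ_x μ(o ↔ x) > 3`, implies the hair condition
(`Σ_x μ(o ↔ x) ≤ 4(1 − Πq)`), and the hair condition is what separates the statement from its hypothesis-free version,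
which is FALSE (`K₅` with `p = 1/20`: memo ENGINE gen 3, `T′(5)`).

PROOF.  `{o ↔ a} ⊆ ({N′ ≥ 2} ∩ {o ↔ a}) ∪ Alone`, `Alone = {o ↔ a only}`; so it suffices that
`μ(Alone) ≤ μ({N′ ≥ 2} ∩ {o ↮ a})`.  Let `Iso = {a ↮ b, a ↮ c, a ↮ d off o}` (an event of the pairs off `o`).
(1) Off a null set (a weight-0 pair at `o` open), `Alone ⊆ {hair a open, hairs b,c,d closed} ∩ Iso`
(first-visit decomposition of an open `o–a` path at `o`, tree `KNPreFKG.walk_decomp`); by independence of the hairs from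
the pairs off `o`, `μ(Alone) ≤ h_a q_b q_c q_d · μ(Iso)`.  (2) `{hair a closed, ≥ 2 of the hairs b,c,d open} ∩ Iso`
lies (off the same null set) in `{N′ ≥ 2} ∩ {o ↮ a}`, and has measure `q_a · m₂ · μ(Iso)`,
`m₂ = h_b(1 − q_c q_d) + q_b h_c h_d`.  (3) The real inequality `h_a q_b q_c q_d ≤ q_a m₂` under `h_a ≤ h_b ≤ h_c, h_d`
and `q_a q_b q_c q_d ≤ 1/4` (`oneLayer_hair_ineq`: the defect is increasing in `h_a`, so push `h_a` up to `h_b`; then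
`q_c q_d ≤ 1/2` because `(q_c q_d)² ≤ q_a q_b q_c q_d`).
[cite: KozmaNitzan2024, Lemma 5 (p. 13) and Thm. 4 (pp. 12–14) — the star decomposition at a one-layer observer]
-/

noncomputable section

namespace Summit.CriticalPhenomena.PercolationContinuityZ3.Theorems

open MeasureTheory Set Literature.Probability.Percolation Literature.Probability.Percolation.KNPreFKG
open Literature.Probability.LatticeModels (prodBernoulli)

open OneLayerTwoFinger

/-- Permutation `(a,d,b,c)` of the "two of four" disjunction. [folklore] -/
private theorem twoOf_perm_adbc (A B C D : Prop) :
    ((A ∧ D) ∨ (A ∧ B) ∨ (A ∧ C) ∨ (D ∧ B) ∨ (D ∧ C) ∨ (B ∧ C)) ↔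
      ((A ∧ B) ∨ (A ∧ C) ∨ (A ∧ D) ∨ (B ∧ C) ∨ (B ∧ D) ∨ (C ∧ D)) := by tauto

/-- Permutation `(a,c,b,d)` of the "two of four" disjunction. [folklore] -/
private theorem twoOf_perm_acbd (A B C D : Prop) :
    ((A ∧ C) ∨ (A ∧ B) ∨ (A ∧ D) ∨ (C ∧ B) ∨ (C ∧ D) ∨ (B ∧ D)) ↔
      ((A ∧ B) ∨ (A ∧ C) ∨ (A ∧ D) ∨ (B ∧ C) ∨ (B ∧ D) ∨ (C ∧ D)) := by tauto

/-- Permutation `(b,a,c,d)` of the "two of four" disjunction. [folklore] -/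
private theorem twoOf_perm_bacd (A B C D : Prop) :
    ((B ∧ A) ∨ (B ∧ C) ∨ (B ∧ D) ∨ (A ∧ C) ∨ (A ∧ D) ∨ (C ∧ D)) ↔
      ((A ∧ B) ∨ (A ∧ C) ∨ (A ∧ D) ∨ (B ∧ C) ∨ (B ∧ D) ∨ (C ∧ D)) := by tauto

/-- Permutation `(c,a,b,d)` of the "two of four" disjunction. [folklore] -/
private theorem twoOf_perm_cabd (A B C D : Prop) :
    ((C ∧ A) ∨ (C ∧ B) ∨ (C ∧ D) ∨ (A ∧ B) ∨ (A ∧ D) ∨ (B ∧ D)) ↔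
      ((A ∧ B) ∨ (A ∧ C) ∨ (A ∧ D) ∨ (B ∧ C) ∨ (B ∧ D) ∨ (C ∧ D)) := by tauto

/-- Permutation `(d,a,b,c)` of the "two of four" disjunction. [folklore] -/
private theorem twoOf_perm_dabc (A B C D : Prop) :
    ((D ∧ A) ∨ (D ∧ B) ∨ (D ∧ C) ∨ (A ∧ B) ∨ (A ∧ C) ∨ (B ∧ C)) ↔
      ((A ∧ B) ∨ (A ∧ C) ∨ (A ∧ D) ∨ (B ∧ C) ∨ (B ∧ D) ∨ (C ∧ D)) := by tauto

/-- **`X′(5)@o` for one-layer observer-relays, weakest-hair form.**  `μ = prodBernoulli w` on a finite vertex type;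
`o` a one-layer observer with targets `a, b, c, d` (distinct, `≠ o`, every other pair at `o` of weight `0`); if the hair
`s(o,a)` is the lightest of the four and `(1−h_a)(1−h_b)(1−h_c)(1−h_d) ≤ 1/4` (⟸ `Σ_x μ(o↔x) > 3`), then
`μ(o ↔ a) ≤ μ(some two of a,b,c,d are both joined to o)`. [cite: KozmaNitzan2024, Lemma 5 (p. 13), Thm. 4 (pp. 12–14)] -/
theorem oneLayer_openConn_weakestHair_le_twoFingers {V : Type*} [Fintype V] [DecidableEq V]
    (w : Sym2 V → unitInterval) (o a b c d : V)
    (hao : a ≠ o) (hbo : b ≠ o) (hco : c ≠ o) (hdo : d ≠ o)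
    (hab : a ≠ b) (hac : a ≠ c) (had : a ≠ d) (hbc : b ≠ c) (hbd : b ≠ d) (hcd : c ≠ d)
    (hiso : ∀ u, u ≠ o → u ≠ a → u ≠ b → u ≠ c → u ≠ d → w s(o, u) = 0)
    (hmb : (w s(o, a) : ℝ) ≤ w s(o, b)) (hmc : (w s(o, a) : ℝ) ≤ w s(o, c)) (hmd : (w s(o, a) : ℝ) ≤ w s(o, d))
    (hHC : (1 - (w s(o, a) : ℝ)) * (1 - w s(o, b)) * (1 - w s(o, c)) * (1 - w s(o, d)) ≤ 1 / 4) :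
    (prodBernoulli w).real (openConn o a) ≤
      (prodBernoulli w).real {ω : BondConfig V |
        (ω ∈ openConn o a ∧ ω ∈ openConn o b) ∨ (ω ∈ openConn o a ∧ ω ∈ openConn o c) ∨
        (ω ∈ openConn o a ∧ ω ∈ openConn o d) ∨ (ω ∈ openConn o b ∧ ω ∈ openConn o c) ∨
        (ω ∈ openConn o b ∧ ω ∈ openConn o d) ∨ (ω ∈ openConn o c ∧ ω ∈ openConn o d)} := by
  by_cases h1 : (w s(o, b) : ℝ) ≤ w s(o, c)
  · by_cases h2 : (w s(o, b) : ℝ) ≤ w s(o, d)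
    · exact oneLayer_core w o a b c d hao hbo hco hdo hab hac had hbc hbd hcd hiso hmb h1 h2 hHC
    · -- `d` carries the least of the three hairs
      have h2' : (w s(o, d) : ℝ) ≤ w s(o, b) := le_of_lt (not_le.1 h2)
      have hHC' : (1 - (w s(o, a) : ℝ)) * (1 - w s(o, d)) * (1 - w s(o, b)) * (1 - w s(o, c)) ≤ 1 / 4 := by
        calc (1 - (w s(o, a) : ℝ)) * (1 - w s(o, d)) * (1 - w s(o, b)) * (1 - w s(o, c))
            = (1 - (w s(o, a) : ℝ)) * (1 - w s(o, b)) * (1 - w s(o, c)) * (1 - w s(o, d)) := by ring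
          _ ≤ 1 / 4 := hHC
      have key := oneLayer_core w o a d b c hao hdo hbo hco had hab hac hbd.symm hcd.symm hbc
        (fun u huo hua hud hub huc => hiso u huo hua hub huc hud) hmd h2' (h2'.trans h1) hHC'
      refine key.trans (le_of_eq ?_)
      congr 1
      exact Set.ext fun ω => twoOf_perm_adbc _ _ _ _
  · have h1' : (w s(o, c) : ℝ) ≤ w s(o, b) := le_of_lt (not_le.1 h1)
    by_cases h3 : (w s(o, c) : ℝ) ≤ w s(o, d)
    · -- `c` carries the least of the three hairs
      have hHC' : (1 - (w s(o, a) : ℝ)) * (1 - w s(o, c)) * (1 - w s(o, b)) * (1 - w s(o, d)) ≤ 1 / 4 := by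
        calc (1 - (w s(o, a) : ℝ)) * (1 - w s(o, c)) * (1 - w s(o, b)) * (1 - w s(o, d))
            = (1 - (w s(o, a) : ℝ)) * (1 - w s(o, b)) * (1 - w s(o, c)) * (1 - w s(o, d)) := by ring
          _ ≤ 1 / 4 := hHC
      have key := oneLayer_core w o a c b d hao hco hbo hdo hac hab had hbc.symm hcd hbd
        (fun u huo hua huc hub hud => hiso u huo hua hub huc hud) hmc h1' h3 hHC'
      refine key.trans (le_of_eq ?_)
      congr 1
      exact Set.ext fun ω => twoOf_perm_acbd _ _ _ _
    · -- `d` carries the least of the three hairs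
      have h3' : (w s(o, d) : ℝ) ≤ w s(o, c) := le_of_lt (not_le.1 h3)
      have hHC' : (1 - (w s(o, a) : ℝ)) * (1 - w s(o, d)) * (1 - w s(o, b)) * (1 - w s(o, c)) ≤ 1 / 4 := by
        calc (1 - (w s(o, a) : ℝ)) * (1 - w s(o, d)) * (1 - w s(o, b)) * (1 - w s(o, c))
            = (1 - (w s(o, a) : ℝ)) * (1 - w s(o, b)) * (1 - w s(o, c)) * (1 - w s(o, d)) := by ring
          _ ≤ 1 / 4 := hHC
      have key := oneLayer_core w o a d b c hao hdo hbo hco had hab hac hbd.symm hcd.symm hbc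
        (fun u huo hua hud hub huc => hiso u huo hua hub huc hud) hmd (h3'.trans h1') h3' hHC'
      refine key.trans (le_of_eq ?_)
      congr 1
      exact Set.ext fun ω => twoOf_perm_adbc _ _ _ _

/-- **`X′(5)@o` (two-finger hub bound, glued form `C6`) for one-layer observer-relays.**  With `o, a, b, c, d` as in
`oneLayer_openConn_weakestHair_le_twoFingers` (no ordering of the hairs assumed) and
`(1−h_a)(1−h_b)(1−h_c)(1−h_d) ≤ 1/4`: some target `x ∈ {a,b,c,d}` has `μ(o ↔ x) ≤ μ(N′ ≥ 2)`; hence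
`min_x μ(o ↔ x) ≤ μ(N′ ≥ 2)`, i.e. `μ(N′ ≤ 1) ≤ max_x μ(o ↮ x)` — the glued half of the |A| = 5 one-cut rung
(`C6` of prim-a5/ASSEMBLY.md §8) for every observer-relay adjacent only to the four other relays.  The regime
`Σ_x μ(o ↔ x) > 3` of `X′(5)` implies the hair condition. [cite: KozmaNitzan2024, Lemma 5 (p. 13), Thm. 4 (pp. 12–14)] -/
theorem oneLayer_twoFingerHub_glued {V : Type*} [Fintype V] [DecidableEq V]
    (w : Sym2 V → unitInterval) (o a b c d : V)
    (hao : a ≠ o) (hbo : b ≠ o) (hco : c ≠ o) (hdo : d ≠ o)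
    (hab : a ≠ b) (hac : a ≠ c) (had : a ≠ d) (hbc : b ≠ c) (hbd : b ≠ d) (hcd : c ≠ d)
    (hiso : ∀ u, u ≠ o → u ≠ a → u ≠ b → u ≠ c → u ≠ d → w s(o, u) = 0)
    (hHC : (1 - (w s(o, a) : ℝ)) * (1 - w s(o, b)) * (1 - w s(o, c)) * (1 - w s(o, d)) ≤ 1 / 4) :
    ∃ x, (x = a ∨ x = b ∨ x = c ∨ x = d) ∧
      (prodBernoulli w).real (openConn o x) ≤
        (prodBernoulli w).real {ω : BondConfig V |
          (ω ∈ openConn o a ∧ ω ∈ openConn o b) ∨ (ω ∈ openConn o a ∧ ω ∈ openConn o c) ∨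
          (ω ∈ openConn o a ∧ ω ∈ openConn o d) ∨ (ω ∈ openConn o b ∧ ω ∈ openConn o c) ∨
          (ω ∈ openConn o b ∧ ω ∈ openConn o d) ∨ (ω ∈ openConn o c ∧ ω ∈ openConn o d)} := by
  -- the four hairs; one result per candidate lightest hair, then a comparison tree
  have resA : (w s(o, a) : ℝ) ≤ (w s(o, b) : ℝ) → (w s(o, a) : ℝ) ≤ (w s(o, c) : ℝ) → (w s(o, a) : ℝ) ≤ (w s(o, d) : ℝ) → ∃ x, (x = a ∨ x = b ∨ x = c ∨ x = d) ∧
      (prodBernoulli w).real (openConn o x) ≤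
        (prodBernoulli w).real {ω : BondConfig V |
          (ω ∈ openConn o a ∧ ω ∈ openConn o b) ∨ (ω ∈ openConn o a ∧ ω ∈ openConn o c) ∨
          (ω ∈ openConn o a ∧ ω ∈ openConn o d) ∨ (ω ∈ openConn o b ∧ ω ∈ openConn o c) ∨
          (ω ∈ openConn o b ∧ ω ∈ openConn o d) ∨ (ω ∈ openConn o c ∧ ω ∈ openConn o d)} :=
    fun h1 h2 h3 => ⟨a, Or.inl rfl, oneLayer_openConn_weakestHair_le_twoFingers w o a b c d hao hbo hco hdo hab hac
      had hbc hbd hcd hiso h1 h2 h3 hHC⟩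
  have resB : (w s(o, b) : ℝ) ≤ (w s(o, a) : ℝ) → (w s(o, b) : ℝ) ≤ (w s(o, c) : ℝ) → (w s(o, b) : ℝ) ≤ (w s(o, d) : ℝ) → ∃ x, (x = a ∨ x = b ∨ x = c ∨ x = d) ∧
      (prodBernoulli w).real (openConn o x) ≤
        (prodBernoulli w).real {ω : BondConfig V |
          (ω ∈ openConn o a ∧ ω ∈ openConn o b) ∨ (ω ∈ openConn o a ∧ ω ∈ openConn o c) ∨
          (ω ∈ openConn o a ∧ ω ∈ openConn o d) ∨ (ω ∈ openConn o b ∧ ω ∈ openConn o c) ∨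
          (ω ∈ openConn o b ∧ ω ∈ openConn o d) ∨ (ω ∈ openConn o c ∧ ω ∈ openConn o d)} := by
    intro h1 h2 h3
    have hHC' : (1 - (w s(o, b) : ℝ)) * (1 - (w s(o, a) : ℝ)) * (1 - (w s(o, c) : ℝ)) * (1 - (w s(o, d) : ℝ)) ≤ 1 / 4 := by
      calc (1 - (w s(o, b) : ℝ)) * (1 - (w s(o, a) : ℝ)) * (1 - (w s(o, c) : ℝ)) * (1 - (w s(o, d) : ℝ)) = (1 - (w s(o, a) : ℝ)) * (1 - (w s(o, b) : ℝ)) * (1 - (w s(o, c) : ℝ)) * (1 - (w s(o, d) : ℝ)) := by ring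
        _ ≤ 1 / 4 := hHC
    have key := oneLayer_openConn_weakestHair_le_twoFingers w o b a c d hbo hao hco hdo hab.symm hbc hbd hac had
      hcd (fun u huo hub hua huc hud => hiso u huo hua hub huc hud) h1 h2 h3 hHC'
    refine ⟨b, Or.inr (Or.inl rfl), key.trans (le_of_eq ?_)⟩
    congr 1
    exact Set.ext fun ω => twoOf_perm_bacd _ _ _ _
  have resC : (w s(o, c) : ℝ) ≤ (w s(o, a) : ℝ) → (w s(o, c) : ℝ) ≤ (w s(o, b) : ℝ) → (w s(o, c) : ℝ) ≤ (w s(o, d) : ℝ) → ∃ x, (x = a ∨ x = b ∨ x = c ∨ x = d) ∧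
      (prodBernoulli w).real (openConn o x) ≤
        (prodBernoulli w).real {ω : BondConfig V |
          (ω ∈ openConn o a ∧ ω ∈ openConn o b) ∨ (ω ∈ openConn o a ∧ ω ∈ openConn o c) ∨
          (ω ∈ openConn o a ∧ ω ∈ openConn o d) ∨ (ω ∈ openConn o b ∧ ω ∈ openConn o c) ∨
          (ω ∈ openConn o b ∧ ω ∈ openConn o d) ∨ (ω ∈ openConn o c ∧ ω ∈ openConn o d)} := by
    intro h1 h2 h3
    have hHC' : (1 - (w s(o, c) : ℝ)) * (1 - (w s(o, a) : ℝ)) * (1 - (w s(o, b) : ℝ)) * (1 - (w s(o, d) : ℝ)) ≤ 1 / 4 := by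
      calc (1 - (w s(o, c) : ℝ)) * (1 - (w s(o, a) : ℝ)) * (1 - (w s(o, b) : ℝ)) * (1 - (w s(o, d) : ℝ)) = (1 - (w s(o, a) : ℝ)) * (1 - (w s(o, b) : ℝ)) * (1 - (w s(o, c) : ℝ)) * (1 - (w s(o, d) : ℝ)) := by ring
        _ ≤ 1 / 4 := hHC
    have key := oneLayer_openConn_weakestHair_le_twoFingers w o c a b d hco hao hbo hdo hac.symm hbc.symm hcd hab
      had hbd (fun u huo huc hua hub hud => hiso u huo hua hub huc hud) h1 h2 h3 hHC'
    refine ⟨c, Or.inr (Or.inr (Or.inl rfl)), key.trans (le_of_eq ?_)⟩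
    congr 1
    exact Set.ext fun ω => twoOf_perm_cabd _ _ _ _
  have resD : (w s(o, d) : ℝ) ≤ (w s(o, a) : ℝ) → (w s(o, d) : ℝ) ≤ (w s(o, b) : ℝ) → (w s(o, d) : ℝ) ≤ (w s(o, c) : ℝ) → ∃ x, (x = a ∨ x = b ∨ x = c ∨ x = d) ∧
      (prodBernoulli w).real (openConn o x) ≤
        (prodBernoulli w).real {ω : BondConfig V |
          (ω ∈ openConn o a ∧ ω ∈ openConn o b) ∨ (ω ∈ openConn o a ∧ ω ∈ openConn o c) ∨
          (ω ∈ openConn o a ∧ ω ∈ openConn o d) ∨ (ω ∈ openConn o b ∧ ω ∈ openConn o c) ∨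
          (ω ∈ openConn o b ∧ ω ∈ openConn o d) ∨ (ω ∈ openConn o c ∧ ω ∈ openConn o d)} := by
    intro h1 h2 h3
    have hHC' : (1 - (w s(o, d) : ℝ)) * (1 - (w s(o, a) : ℝ)) * (1 - (w s(o, b) : ℝ)) * (1 - (w s(o, c) : ℝ)) ≤ 1 / 4 := by
      calc (1 - (w s(o, d) : ℝ)) * (1 - (w s(o, a) : ℝ)) * (1 - (w s(o, b) : ℝ)) * (1 - (w s(o, c) : ℝ)) = (1 - (w s(o, a) : ℝ)) * (1 - (w s(o, b) : ℝ)) * (1 - (w s(o, c) : ℝ)) * (1 - (w s(o, d) : ℝ)) := by ring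
        _ ≤ 1 / 4 := hHC
    have key := oneLayer_openConn_weakestHair_le_twoFingers w o d a b c hdo hao hbo hco had.symm hbd.symm hcd.symm
      hab hac hbc (fun u huo hud hua hub huc => hiso u huo hua hub huc hud) h1 h2 h3 hHC'
    refine ⟨d, Or.inr (Or.inr (Or.inr rfl)), key.trans (le_of_eq ?_)⟩
    congr 1
    exact Set.ext fun ω => twoOf_perm_dabc _ _ _ _
  -- comparison tree
  rcases le_total (w s(o, a) : ℝ) (w s(o, b) : ℝ) with h_ab | h_ba
  · rcases le_total (w s(o, c) : ℝ) (w s(o, d) : ℝ) with h_cd | h_dc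
    · rcases le_total (w s(o, a) : ℝ) (w s(o, c) : ℝ) with h_ac | h_ca
      · exact resA h_ab h_ac (h_ac.trans h_cd)
      · exact resC h_ca (h_ca.trans h_ab) h_cd
    · rcases le_total (w s(o, a) : ℝ) (w s(o, d) : ℝ) with h_ad | h_da
      · exact resA h_ab (h_ad.trans h_dc) h_ad
      · exact resD h_da (h_da.trans h_ab) h_dc
  · rcases le_total (w s(o, c) : ℝ) (w s(o, d) : ℝ) with h_cd | h_dc
    · rcases le_total (w s(o, b) : ℝ) (w s(o, c) : ℝ) with h_bc | h_cb
      · exact resB h_ba h_bc (h_bc.trans h_cd)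
      · exact resC (h_cb.trans h_ba) h_cb h_cd
    · rcases le_total (w s(o, b) : ℝ) (w s(o, d) : ℝ) with h_bd | h_db
      · exact resB h_ba (h_bd.trans h_dc) h_bd
      · exact resD (h_db.trans h_ba) h_db h_dc

end Summit.CriticalPhenomena.PercolationContinuityZ3.Theorems

end
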